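import Mathlib.Algebra.BigOperators.Field
import Mathlib.Tactic.Push
import Literature.Analysis.Convexity.SignArrangement
import HarnessLib

/-!
# Sign arrangements: chains of faces and uniqueness of positive chain representations

Continuation of `Literature.Analysis.Convexity.SignArrangement`.  Fix a finite set `Φ` of sign
vectors and chosen points `b ε ∈ face L ε` (`ε ∈ Φ`).  A *chain* is a finite subset of `Φ`
totally ordered by the face order `SLE` (Mathlib's `IsChain SLE`); its *chain simplex* is the
convex hull of the chosen points `b G`, `G` in the chain.

* `exists_max_of_isChain` — a nonempty finite chain has a greatest element;
* `sum_smul_mem_face` — a convex combination with positive weights of the chosen points over a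
  set of faces with greatest element `F` lies in `face L F` (so the face of a point of a chain
  simplex is read off from the support of its weights);
* `affineIndependent_of_isChain` — the chosen points of a chain are affinely independent
  (a functional vanishing on all faces below the top one but not on the top one separates);
* `eq_of_sum_smul_eq` — **uniqueness of positive chain representations**: a point which is a
  positive convex combination of chosen points over a chain `S` and also over a chain `S'` has
  `S = S'` with the same weights (peel off the common greatest element using the uniqueness of
  the exit point, `eq_of_mem_cl_diff_face`, and induct);
* `convexHull_image_inter_subset` — hence two chain simplices meet in the simplex of the common
  sub-chain: the intersection axiom of a geometric simplicial complex.

All statements are standard (the derived / barycentric subdivision of the cell complex of an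
arrangement, with arbitrary interior points in place of barycentres) and tagged `[folklore]`.
-/

open Set Function

noncomputable section

namespace Literature.Analysis.Convexity

namespace SignArrangement

variable {E : Type*} [AddCommGroup E] [Module ℝ E] {ι : Type*} {L : ι → E →ᵃ[ℝ] ℝ}
  {ε : ι → SignType}

/-! ### Chains of faces and the chain simplices -/

section Chains

variable {Φ : Finset (ι → SignType)} {b : (ι → SignType) → E} {C : Finset (ι → SignType)}
  {F G : ι → SignType}

/-- If `G` is strictly below `F` then some functional vanishes on the face `G` but not on the
face `F`. [folklore] -/
theorem SLE.exists_eq_zero_ne_zero (h : SLE G F) (hne : G ≠ F) : ∃ i, G i = 0 ∧ F i ≠ 0 := by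
  by_contra hcon
  push Not at hcon
  refine hne (funext fun i => ?_)
  rcases h i with h0 | hEq
  · exact h0.trans (hcon i h0).symm
  · exact hEq

/-- Two elements of a chain are comparable. [folklore] -/
theorem total_of_isChain (hC : IsChain SLE (C : Set (ι → SignType))) (hF : F ∈ C) (hG : G ∈ C) :
    SLE F G ∨ SLE G F := by
  by_cases hFG : F = G
  · subst hFG
    exact Or.inl SLE.rfl
  · exact hC hF hG hFG

/-- A nonempty finite chain of sign vectors has a greatest element. [folklore] -/
theorem exists_max_of_isChain [DecidableEq ι] (hC : IsChain SLE (C : Set (ι → SignType)))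
    (hne : C.Nonempty) : ∃ F ∈ C, ∀ G ∈ C, SLE G F := by
  classical
  induction C using Finset.induction_on with
  | empty => exact (Finset.not_nonempty_empty hne).elim
  | @insert a C haC ih =>
    rcases C.eq_empty_or_nonempty with rfl | hCne
    · refine ⟨a, Finset.mem_insert_self a ∅, fun G hG => ?_⟩
      rw [Finset.mem_insert] at hG
      rcases hG with rfl | hG
      · exact SLE.rfl
      · simp at hG
    · have hC' : IsChain SLE (C : Set (ι → SignType)) :=
        hC.mono (by rw [Finset.coe_insert]; exact Set.subset_insert _ _)
      obtain ⟨F, hF, hFmax⟩ := ih hC' hCne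
      rcases total_of_isChain hC (Finset.mem_insert_self a C) (Finset.mem_insert_of_mem hF)
        with h | h
      · refine ⟨F, Finset.mem_insert_of_mem hF, fun G hG => ?_⟩
        rcases Finset.mem_insert.1 hG with rfl | hG
        exacts [h, hFmax G hG]
      · refine ⟨a, Finset.mem_insert_self a C, fun G hG => ?_⟩
        rcases Finset.mem_insert.1 hG with rfl | hG
        exacts [SLE.rfl, (hFmax G hG).trans h]

/-- A convex combination with *positive* weights of the chosen points `b G`, `G` ranging over a
finite set of sign vectors with greatest element `F`, lies in the face `F`. [folklore] -/
theorem sum_smul_mem_face [DecidableEq ι] (hb : ∀ ε ∈ Φ, b ε ∈ face L ε) (hCΦ : C ⊆ Φ)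
    (hF : F ∈ C) (hmax : ∀ G ∈ C, SLE G F) {w : (ι → SignType) → ℝ} (hw : ∀ G ∈ C, 0 < w G)
    (hw1 : ∑ G ∈ C, w G = 1) : ∑ G ∈ C, w G • b G ∈ face L F := by
  classical
  rw [← Finset.add_sum_erase C _ hF]
  set W : ℝ := ∑ G ∈ C.erase F, w G with hW
  have hW1 : w F + W = 1 := by rw [hW, Finset.add_sum_erase C w hF]; exact hw1
  rcases (C.erase F).eq_empty_or_nonempty with h0 | hne
  · have hW0 : W = 0 := by rw [hW, h0, Finset.sum_empty]
    have hwF : w F = 1 := by linarith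
    rw [h0, Finset.sum_empty, add_zero, hwF, one_smul]
    exact hb F (hCΦ hF)
  · have hWpos : 0 < W := Finset.sum_pos (fun G hG => hw G (Finset.mem_of_mem_erase hG)) hne
    set q : E := ∑ G ∈ C.erase F, (w G / W) • b G with hq
    have hqcl : q ∈ cl L F := by
      refine (convex_cl L F).sum_mem (fun G hG => (div_pos (hw G (Finset.mem_of_mem_erase hG))
        hWpos).le) ?_ fun G hG => ?_
      · rw [← Finset.sum_div, div_self hWpos.ne']
      · exact cl_mono (hmax G (Finset.mem_of_mem_erase hG))
          (face_subset_cl (hb G (hCΦ (Finset.mem_of_mem_erase hG))))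
    have hWq : W • q = ∑ G ∈ C.erase F, w G • b G := by
      rw [hq, Finset.smul_sum]
      refine Finset.sum_congr rfl fun G _ => ?_
      rw [smul_smul, mul_div_cancel₀ _ hWpos.ne']
    rw [← hWq]
    exact combo_mem_face (hb F (hCΦ hF)) hqcl (hw F hF) hWpos.le hW1

/-- The chain simplex spanned by the chosen points of a set of faces with greatest element `F`
lies in the closed face `F`. [folklore] -/
theorem convexHull_image_subset_cl [DecidableEq E] (hb : ∀ ε ∈ Φ, b ε ∈ face L ε) (hCΦ : C ⊆ Φ)
    (hmax : ∀ G ∈ C, SLE G F) : convexHull ℝ ((C.image b : Finset E) : Set E) ⊆ cl L F := by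
  refine convexHull_min ?_ (convex_cl L F)
  intro x hx
  rw [Finset.coe_image] at hx
  obtain ⟨G, hG, rfl⟩ := hx
  exact cl_mono (hmax G hG) (face_subset_cl (hb G (hCΦ hG)))

/-- The chosen points of a chain of faces are affinely independent: the greatest face `F` of
the chain is separated from the others by a functional vanishing on all smaller faces but not
on `F`. [folklore] -/
theorem affineIndependent_of_isChain [DecidableEq ι] [DecidableEq E]
    (hb : ∀ ε ∈ Φ, b ε ∈ face L ε) :
    ∀ C : Finset (ι → SignType), C ⊆ Φ → IsChain SLE (C : Set (ι → SignType)) →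
      AffineIndependent ℝ ((↑) : ↥((C.image b : Finset E) : Set E) → E) := by
  intro C
  classical
  induction C using Finset.strongInduction with
  | H C ih =>
    intro hCΦ hC
    rcases C.eq_empty_or_nonempty with rfl | hne
    · rw [Finset.image_empty, Finset.coe_empty]
      exact affineIndependent_of_subsingleton ℝ _
    obtain ⟨F, hF, hmax⟩ := exists_max_of_isChain hC hne
    have hCe : IsChain SLE ((C.erase F : Finset _) : Set (ι → SignType)) :=
      hC.mono (by rw [Finset.coe_erase]; exact Set.sdiff_subset)
    have ih' := ih (C.erase F) (Finset.erase_ssubset hF) ((Finset.erase_subset F C).trans hCΦ) hCe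
    have himage : ((C.image b : Finset E) : Set E) =
        insert (b F) (((C.erase F).image b : Finset E) : Set E) := by
      rw [← Finset.coe_insert, ← Finset.image_insert, Finset.insert_erase hF]
    rw [himage]
    refine affineIndependent_insert_of_notMem ih' fun hmem => ?_
    rcases (C.erase F).eq_empty_or_nonempty with h0 | hne'
    · rw [h0, Finset.image_empty, Finset.coe_empty, AffineSubspace.span_empty] at hmem
      exact (AffineSubspace.notMem_bot ℝ E (b F)) hmem
    obtain ⟨G₁, hG₁, hmax₁⟩ := exists_max_of_isChain hCe hne'
    obtain ⟨i, hi0, hiF⟩ :=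
      (hmax G₁ (Finset.mem_of_mem_erase hG₁)).exists_eq_zero_ne_zero (Finset.ne_of_mem_erase hG₁)
    have hS0 : (L i) '' (((C.erase F).image b : Finset E) : Set E) ⊆ {0} := by
      rintro _ ⟨z, hz, rfl⟩
      rw [Finset.coe_image] at hz
      obtain ⟨G, hG, rfl⟩ := hz
      have hGi : G i = 0 := (hmax₁ G hG).apply_eq_zero hi0
      have hsg : SignType.sign (L i (b G)) = G i :=
        congr_fun (hb G (hCΦ (Finset.mem_of_mem_erase hG))) i
      rw [hGi] at hsg
      exact sign_eq_zero_iff.1 hsg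
    have h1 : L i (b F) ∈ (affineSpan ℝ (((C.erase F).image b : Finset E) : Set E)).map (L i) :=
      AffineSubspace.mem_map.2 ⟨b F, hmem, rfl⟩
    rw [AffineSubspace.map_span] at h1
    have h2 : L i (b F) ∈ (affineSpan ℝ ({0} : Set ℝ) : Set ℝ) := affineSpan_mono ℝ hS0 h1
    rw [AffineSubspace.coe_affineSpan_singleton, Set.mem_singleton_iff] at h2
    have hFi : SignType.sign (L i (b F)) = F i := congr_fun (hb F (hCΦ hF)) i
    rw [h2, sign_zero] at hFi
    exact hiF hFi.symm

/-- The chain obtained by erasing an element is a chain. [folklore] -/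
theorem isChain_erase [DecidableEq (ι → SignType)] (hC : IsChain SLE (C : Set (ι → SignType)))
    (F : ι → SignType) :
    IsChain SLE ((C.erase F : Finset (ι → SignType)) : Set (ι → SignType)) :=
  hC.mono (by rw [Finset.coe_erase]; exact Set.sdiff_subset)

/-- If a positive convex combination of the chosen points over a chain containing `F` equals
the chosen point `b F`, the chain is `{F}`. [folklore] -/
theorem eq_singleton_of_sum_smul_eq [DecidableEq ι] (hb : ∀ ε ∈ Φ, b ε ∈ face L ε) (hCΦ : C ⊆ Φ)
    (hC : IsChain SLE (C : Set (ι → SignType))) (hF : F ∈ C)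
    {w : (ι → SignType) → ℝ} (hw : ∀ G ∈ C, 0 < w G) (hw1 : ∑ G ∈ C, w G = 1)
    (heq : ∑ G ∈ C, w G • b G = b F) : C = {F} := by
  classical
  rcases (C.erase F).eq_empty_or_nonempty with h0 | hne
  · rw [← Finset.insert_erase hF, h0]
    rfl
  exfalso
  set W : ℝ := ∑ G ∈ C.erase F, w G with hW
  have hW1 : w F + W = 1 := by rw [hW, Finset.add_sum_erase C w hF]; exact hw1
  have hWpos : 0 < W := Finset.sum_pos (fun G hG => hw G (Finset.mem_of_mem_erase hG)) hne
  obtain ⟨G₁, hG₁, hmax₁⟩ := exists_max_of_isChain (isChain_erase hC F) hne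
  have hsub : C.erase F ⊆ Φ := (Finset.erase_subset F C).trans hCΦ
  set q : E := ∑ G ∈ C.erase F, (w G / W) • b G with hq
  have hqface : q ∈ face L G₁ :=
    sum_smul_mem_face hb hsub hG₁ hmax₁
      (fun G hG => div_pos (hw G (Finset.mem_of_mem_erase hG)) hWpos)
      (by rw [← Finset.sum_div, div_self hWpos.ne'])
  have hWq : W • q = ∑ G ∈ C.erase F, w G • b G := by
    rw [hq, Finset.smul_sum]
    refine Finset.sum_congr rfl fun G _ => ?_
    rw [smul_smul, mul_div_cancel₀ _ hWpos.ne']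
  -- from `heq`: `W • q = W • b F`, so `q = b F`
  have hqF : q = b F := by
    have h1 : w F • b F + W • q = b F := by
      rw [hWq, Finset.add_sum_erase C (fun G => w G • b G) hF]
      exact heq
    have h2 : W • q = W • b F := by
      have hwF : w F = 1 - W := by linarith
      rw [hwF, sub_smul, one_smul] at h1
      calc W • q = (b F - W • b F + W • q) - (b F - W • b F) := by abel
        _ = b F - (b F - W • b F) := by rw [h1]
        _ = W • b F := by abel
    exact smul_right_injective E hWpos.ne' h2
  have h1 : svec L (b F) = G₁ := hqF ▸ hqface
  have h2 : svec L (b F) = F := hb F (hCΦ hF)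
  exact Finset.ne_of_mem_erase hG₁ (h1.symm.trans h2)

/-- **Uniqueness of positive chain representations.** If a point is a convex combination with
positive weights of the chosen points over a chain `S`, and also over a chain `S'`, then
`S = S'` and the weights agree.  (Induction on `|S| + |S'|`: both greatest elements are the
face containing the point; peel them off using the uniqueness of the exit point of a ray,
`eq_of_mem_cl_diff_face`.) [folklore] -/
theorem eq_of_sum_smul_eq [DecidableEq ι] (hb : ∀ ε ∈ Φ, b ε ∈ face L ε) :
    ∀ (S S' : Finset (ι → SignType)) (w w' : (ι → SignType) → ℝ), S ⊆ Φ → S' ⊆ Φ →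
      IsChain SLE (S : Set (ι → SignType)) → IsChain SLE (S' : Set (ι → SignType)) →
      S.Nonempty → S'.Nonempty → (∀ G ∈ S, 0 < w G) → ∑ G ∈ S, w G = 1 →
      (∀ G ∈ S', 0 < w' G) → ∑ G ∈ S', w' G = 1 →
      ∑ G ∈ S, w G • b G = ∑ G ∈ S', w' G • b G → S = S' ∧ ∀ G ∈ S, w G = w' G := by
  classical
  suffices h : ∀ n (S S' : Finset (ι → SignType)) (w w' : (ι → SignType) → ℝ),
      S.card + S'.card = n → S ⊆ Φ → S' ⊆ Φ →
      IsChain SLE (S : Set (ι → SignType)) → IsChain SLE (S' : Set (ι → SignType)) →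
      S.Nonempty → S'.Nonempty → (∀ G ∈ S, 0 < w G) → ∑ G ∈ S, w G = 1 →
      (∀ G ∈ S', 0 < w' G) → ∑ G ∈ S', w' G = 1 →
      ∑ G ∈ S, w G • b G = ∑ G ∈ S', w' G • b G → S = S' ∧ ∀ G ∈ S, w G = w' G from
    fun S S' w w' => h _ S S' w w' rfl
  intro n
  induction n using Nat.strong_induction_on with
  | _ n ih =>
  intro S S' w w' hn hS hS' hC hC' hne hne' hw hw1 hw' hw1' heq
  obtain ⟨F, hF, hmax⟩ := exists_max_of_isChain hC hne
  obtain ⟨F', hF', hmax'⟩ := exists_max_of_isChain hC' hne'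
  have hxF : ∑ G ∈ S, w G • b G ∈ face L F := sum_smul_mem_face hb hS hF hmax hw hw1
  have hxF' : ∑ G ∈ S', w' G • b G ∈ face L F' := sum_smul_mem_face hb hS' hF' hmax' hw' hw1'
  have hFF' : F = F' := by
    rw [heq] at hxF
    exact hxF.symm.trans hxF'
  subst hFF'
  -- the two degenerate cases `S = {F}` / `S' = {F}`
  have single : ∀ (T T' : Finset (ι → SignType)) (v v' : (ι → SignType) → ℝ), T ⊆ Φ → T' ⊆ Φ →
      IsChain SLE (T' : Set (ι → SignType)) → F ∈ T → F ∈ T' →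
      (∀ G ∈ T, 0 < v G) → ∑ G ∈ T, v G = 1 → (∀ G ∈ T', 0 < v' G) → ∑ G ∈ T', v' G = 1 →
      ∑ G ∈ T, v G • b G = ∑ G ∈ T', v' G • b G → T.erase F = ∅ →
      T = T' ∧ ∀ G ∈ T, v G = v' G := by
    intro T T' v v' hT hT' hCT' hFT hFT' hv hv1 hv' hv1' hveq h0
    have hT1 : T = {F} := by rw [← Finset.insert_erase hFT, h0]; rfl
    have hvF : v F = 1 := by rw [hT1, Finset.sum_singleton] at hv1; exact hv1
    have hx : ∑ G ∈ T', v' G • b G = b F := by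
      rw [← hveq, hT1, Finset.sum_singleton, hvF, one_smul]
    have hT'1 : T' = {F} := eq_singleton_of_sum_smul_eq hb hT' hCT' hFT' hv' hv1' hx
    refine ⟨hT1.trans hT'1.symm, fun G hG => ?_⟩
    rw [hT1, Finset.mem_singleton] at hG
    subst hG
    rw [hT'1, Finset.sum_singleton] at hv1'
    rw [hvF, hv1']
  by_cases h1 : S.erase F = ∅
  · exact single S S' w w' hS hS' hC' hF hF' hw hw1 hw' hw1' heq h1
  by_cases h2 : S'.erase F = ∅
  · obtain ⟨hSS, hww⟩ := single S' S w' w hS' hS hC hF' hF hw' hw1' hw hw1 heq.symm h2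
    exact ⟨hSS.symm, fun G hG => (hww G (hSS ▸ hG)).symm⟩
  -- main case: peel off the common greatest element `F`
  have hne1 : (S.erase F).Nonempty := Finset.nonempty_iff_ne_empty.2 h1
  have hne2 : (S'.erase F).Nonempty := Finset.nonempty_iff_ne_empty.2 h2
  have hsub1 : S.erase F ⊆ Φ := (Finset.erase_subset F S).trans hS
  have hsub2 : S'.erase F ⊆ Φ := (Finset.erase_subset F S').trans hS'
  set W : ℝ := ∑ G ∈ S.erase F, w G with hW
  set W' : ℝ := ∑ G ∈ S'.erase F, w' G with hW'
  have hWpos : 0 < W := Finset.sum_pos (fun G hG => hw G (Finset.mem_of_mem_erase hG)) hne1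
  have hW'pos : 0 < W' := Finset.sum_pos (fun G hG => hw' G (Finset.mem_of_mem_erase hG)) hne2
  have hW1 : w F + W = 1 := by rw [hW, Finset.add_sum_erase S w hF]; exact hw1
  have hW1' : w' F + W' = 1 := by rw [hW', Finset.add_sum_erase S' w' hF']; exact hw1'
  set q : E := ∑ G ∈ S.erase F, (w G / W) • b G with hq
  set q' : E := ∑ G ∈ S'.erase F, (w' G / W') • b G with hq'
  have hwq : ∀ G ∈ S.erase F, 0 < w G / W := fun G hG =>
    div_pos (hw G (Finset.mem_of_mem_erase hG)) hWpos
  have hwq' : ∀ G ∈ S'.erase F, 0 < w' G / W' := fun G hG =>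
    div_pos (hw' G (Finset.mem_of_mem_erase hG)) hW'pos
  have hwq1 : ∑ G ∈ S.erase F, w G / W = 1 := by rw [← Finset.sum_div, div_self hWpos.ne']
  have hwq1' : ∑ G ∈ S'.erase F, w' G / W' = 1 := by rw [← Finset.sum_div, div_self hW'pos.ne']
  -- `q`, `q'` lie in the closed face `F` but not in the face `F`
  have hqcl : ∀ {T : Finset (ι → SignType)} {v : (ι → SignType) → ℝ}, T ⊆ Φ →
      IsChain SLE (T : Set (ι → SignType)) → (T.erase F).Nonempty → (∀ G ∈ T, SLE G F) →
      (∀ G ∈ T.erase F, 0 < v G) → ∑ G ∈ T.erase F, v G = 1 →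
      ∑ G ∈ T.erase F, v G • b G ∈ cl L F \ face L F := by
    intro T v hT hCT hneT hmaxT hv hv1
    obtain ⟨G₁, hG₁, hmax₁⟩ := exists_max_of_isChain (isChain_erase hCT F) hneT
    have hface : ∑ G ∈ T.erase F, v G • b G ∈ face L G₁ :=
      sum_smul_mem_face hb ((Finset.erase_subset F T).trans hT) hG₁ hmax₁ hv hv1
    refine ⟨cl_mono (hmaxT G₁ (Finset.mem_of_mem_erase hG₁)) (face_subset_cl hface), fun h => ?_⟩
    exact Finset.ne_of_mem_erase hG₁ (hface.symm.trans h)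
  have hq1 : q ∈ cl L F \ face L F := hqcl hS hC hne1 hmax hwq hwq1
  have hq1' : q' ∈ cl L F \ face L F := hqcl hS' hC' hne2 hmax' hwq' hwq1'
  -- `x = w F • b F + W • q = w' F • b F + W' • q'`
  set x : E := ∑ G ∈ S, w G • b G with hx
  have hWq : W • q = ∑ G ∈ S.erase F, w G • b G := by
    rw [hq, Finset.smul_sum]
    refine Finset.sum_congr rfl fun G _ => ?_
    rw [smul_smul, mul_div_cancel₀ _ hWpos.ne']
  have hWq' : W' • q' = ∑ G ∈ S'.erase F, w' G • b G := by
    rw [hq', Finset.smul_sum]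
    refine Finset.sum_congr rfl fun G _ => ?_
    rw [smul_smul, mul_div_cancel₀ _ hW'pos.ne']
  have hxq : x = w F • b F + W • q := by
    rw [hx, hWq, Finset.add_sum_erase S (fun G => w G • b G) hF]
  have hxq' : x = w' F • b F + W' • q' := by
    rw [heq, hWq', Finset.add_sum_erase S' (fun G => w' G • b G) hF']
  have hray : ∀ {V : ℝ} {r : E} (u : ℝ), 0 < V → u + V = 1 → x = u • b F + V • r →
      r = b F + (1 / V) • (x - b F) := by
    intro V r u hV huV hxr
    have hu : u = 1 - V := by linarith
    have : x - b F = V • (r - b F) := by rw [hxr, hu, sub_smul, one_smul, smul_sub]; abel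
    rw [this, smul_smul, one_div, inv_mul_cancel₀ hV.ne', one_smul]
    abel
  have hqray : q = b F + (1 / W) • (x - b F) := hray (w F) hWpos hW1 hxq
  have hq'ray : q' = b F + (1 / W') • (x - b F) := hray (w' F) hW'pos hW1' hxq'
  have hWW' : W = W' := by
    have h := eq_of_mem_cl_diff_face (hb F (hS hF)) (d := x - b F) (one_div_pos.2 hWpos)
      (one_div_pos.2 hW'pos) (hqray ▸ hq1) (hq'ray ▸ hq1')
    rwa [one_div, one_div, inv_inj] at h
  have hwF : w F = w' F := by linarith
  have hqq' : q = q' := by rw [hqray, hq'ray, hWW']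
  -- induction hypothesis for the peeled chains
  have hcard : (S.erase F).card + (S'.erase F).card < n := by
    have h1 := Finset.card_erase_add_one hF
    have h2 := Finset.card_erase_add_one hF'
    omega
  obtain ⟨hCC', hww'⟩ := ih _ hcard (S.erase F) (S'.erase F) (fun G => w G / W)
    (fun G => w' G / W') rfl hsub1 hsub2 (isChain_erase hC F) (isChain_erase hC' F) hne1 hne2
    hwq hwq1 hwq' hwq1' hqq'
  refine ⟨by rw [← Finset.insert_erase hF, ← Finset.insert_erase hF', hCC'], fun G hG => ?_⟩
  by_cases hGF : G = F
  · rw [hGF, hwF]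
  · have h : w G / W = w' G / W' := hww' G (Finset.mem_erase.2 ⟨hGF, hG⟩)
    rw [hWW'] at h
    exact (div_left_inj' hW'pos.ne').1 h

/-- Two chain simplices meet in a common face: consequence of the uniqueness of positive
chain representations `eq_of_sum_smul_eq`. [folklore] -/
theorem convexHull_image_inter_subset [DecidableEq E] (hb : ∀ ε ∈ Φ, b ε ∈ face L ε)
    {C₁ C₂ : Finset (ι → SignType)} (h₁ : C₁ ⊆ Φ) (h₂ : C₂ ⊆ Φ)
    (hC₁ : IsChain SLE (C₁ : Set (ι → SignType))) (hC₂ : IsChain SLE (C₂ : Set (ι → SignType))) :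
    convexHull ℝ ((C₁.image b : Finset E) : Set E) ∩ convexHull ℝ ((C₂.image b : Finset E) : Set E)
      ⊆ convexHull ℝ (((C₁.image b : Finset E) : Set E) ∩ ((C₂.image b : Finset E) : Set E)) := by
  classical
  rintro x ⟨hx₁, hx₂⟩
  -- positive chain representations of `x` from the two convex-hull memberships
  have key : ∀ {C : Finset (ι → SignType)}, C ⊆ Φ → x ∈ convexHull ℝ ((C.image b : Finset E) : Set E) →
      ∃ (S : Finset (ι → SignType)) (w : (ι → SignType) → ℝ), S ⊆ C ∧ S.Nonempty ∧
        (∀ G ∈ S, 0 < w G) ∧ ∑ G ∈ S, w G = 1 ∧ ∑ G ∈ S, w G • b G = x := by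
    intro C hC hx
    obtain ⟨μ, hμ0, hμ1, hμx⟩ := Finset.mem_convexHull'.1 hx
    -- chosen points of distinct faces are distinct: `hb` says `svec L` is a left inverse of `b`
    -- on `Φ`, so `b` is injective on `Φ` (`Set.LeftInvOn.injOn`)
    have hΦ : Set.InjOn b (Φ : Set (ι → SignType)) := LeftInvOn.injOn hb
    have hinj : ∀ G ∈ C, ∀ G' ∈ C, b G = b G' → G = G' := fun G hG G' hG' h =>
      hΦ (hC hG) (hC hG') h
    rw [Finset.sum_image hinj] at hμ1 hμx
    set S : Finset (ι → SignType) := C.filter fun G => μ (b G) ≠ 0 with hS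
    have hμS : ∀ G ∈ C, G ∉ S → μ (b G) = 0 := fun G hGC hGS => by
      by_contra h
      exact hGS (Finset.mem_filter.2 ⟨hGC, h⟩)
    have hsum1 : ∑ G ∈ S, μ (b G) = ∑ G ∈ C, μ (b G) :=
      Finset.sum_subset (Finset.filter_subset _ _) hμS
    have hsumx : ∑ G ∈ S, μ (b G) • b G = ∑ G ∈ C, μ (b G) • b G :=
      Finset.sum_subset (Finset.filter_subset _ _) fun G hGC hGS => by
        rw [hμS G hGC hGS, zero_smul]
    refine ⟨S, fun G => μ (b G), Finset.filter_subset _ _, ?_, ?_, ?_, ?_⟩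
    · refine Finset.nonempty_iff_ne_empty.2 fun h0 => ?_
      rw [h0, Finset.sum_empty, hμ1] at hsum1
      exact zero_ne_one hsum1
    · intro G hG
      have hG' := Finset.mem_filter.1 hG
      exact lt_of_le_of_ne (hμ0 _ (Finset.mem_image_of_mem b hG'.1)) (Ne.symm hG'.2)
    · show ∑ G ∈ S, μ (b G) = 1
      rw [hsum1, hμ1]
    · show ∑ G ∈ S, μ (b G) • b G = x
      rw [hsumx, hμx]
  obtain ⟨S₁, w₁, hS₁, hne₁, hw₁, hw₁1, hx₁eq⟩ := key h₁ hx₁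
  obtain ⟨S₂, w₂, hS₂, hne₂, hw₂, hw₂1, hx₂eq⟩ := key h₂ hx₂
  obtain ⟨hS, -⟩ := eq_of_sum_smul_eq hb S₁ S₂ w₁ w₂ (hS₁.trans h₁) (hS₂.trans h₂)
    (hC₁.mono (Finset.coe_subset.2 hS₁)) (hC₂.mono (Finset.coe_subset.2 hS₂)) hne₁ hne₂
    hw₁ hw₁1 hw₂ hw₂1 (hx₁eq.trans hx₂eq.symm)
  rw [← hx₁eq]
  refine (convex_convexHull ℝ _).sum_mem (fun G hG => (hw₁ G hG).le) hw₁1 fun G hG => ?_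
  refine subset_convexHull ℝ _ ⟨?_, ?_⟩
  · exact Finset.mem_coe.2 (Finset.mem_image_of_mem b (hS₁ hG))
  · exact Finset.mem_coe.2 (Finset.mem_image_of_mem b (hS₂ (hS ▸ hG)))

end Chains

end SignArrangement

end Literature.Analysis.Convexity
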